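import Mathlib
import Summits.NavierStokesRegularity.NavierStokesRegularity.Theorems.EulerZoomLiouvillePowerGaugeEulerLiouvilleSelfSimilarSwirlFatTail
import Summits.NavierStokesRegularity.NavierStokesRegularity.Theorems.EulerZoomLiouvillePowerGaugeEulerLiouvilleSelfSimilarBernoulliBounded
import HarnessLib

/-!
# Crux E `PowerGaugeEulerLiouville` (stmt-NavierStokesRegularity-19832), THE ONE STATEMENT: THE SWIRL RATCHET, VI — SWIRL PUMPS THE BERNOULLI FUNCTION:
# an axisymmetric `C²` needle with `ℋ` bounded above on its swirl set is swirl-free, hence trivial — NO pressure clause (width seat ns-ezl-w3 g3)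

Route №10 `EulerZoomLiouville` (NavierStokesRegularity), crux E; LEAD ns-typeII-p2 g12.  RESIDUE-MEMO-19832-g12 §4 (A1) reads the `ℋ`-bounded branch of the needle
WITHOUT the pressure clause: along a backward similarity orbit `Y′ = −W(Y)` the kinetic budget `(1−2γ)∫‖W(Y)‖² = ℋ(Y τ) − ℋ(Y 1)` (the LEAD's
`Loc.integral_norm_transport_sq_eq`, CIV (3.31)) is bounded when `ℋ ≤ Mb` along the orbit, so the orbit escapes only DIFFUSIVELY/LINEARLY,
`‖Y τ‖ ≤ ‖Y 1‖ + (budget + τ)/2` (`‖W‖ ≤ (‖W‖² + 1)/2`), and the volume race is lost.  For the SWIRL it is won: the ratchet (ns-ezl-w3 g3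
`SwirlRatchet.swirl_backward_orbit`) gives `|Γ(Y τ)| = e^{(1−2γ)τ}|Γ(y)|` while linear growth caps `|Γ(Y τ)| ≤ K₁(‖Y τ‖ + ‖Y τ‖²) = O(τ²)`.  Hence:

* `SwirlRatchet.hasNoSwirl_of_bernoulli_le` — **`ℋ` BOUNDED ABOVE ON THE SWIRL SET ⇒ NO SWIRL**: `(U, P)` a `C²` self-similar Euler profile (CIV (3.3)), `γ < ½`,
  `U` axisymmetric of linear growth, `ℋ_P ≤ Mb` on `{swirl U ≠ 0}` (e.g. `ℋ_P` bounded above on `ℝ³`) ⇒ `HasNoSwirl U`.  No unpressurised clause, no thinness, no volume.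
* MEMBER FORM `SwirlRatchet.selfSimilar_ae_eq_zero_of_axisym_bernoulliBounded_C2` — crux binders verbatim (`0 < ρ ≤ ½`) + exactly self-similar ansatz + `ContDiff ℝ 2 V` +
  `IsAxisymmetric V` + linear growth + «for every classical pressure `P′` of `V`, `ℋ_{P′}` is bounded above on the swirl set» ⇒ `u = 0` a.e. ((S37) after the ratchet).
  Compare the LEAD's `Loc.selfSimilar_ae_eq_zero_of_boundedBernoulliC2_profile` (p629868: bounded `ℋ` AND unpressurised far field, any geometry) and
  `HasVorticalBernoulliBound` (v48: `ℋ`-bound on the vortical set AND the pressure clause): in the axisymmetric class the PRESSURE CLAUSE DROPS.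
  PORTRAIT: a swirling axisymmetric `C²` needle of linear growth PUMPS `ℋ` to `+∞` along its swirl set — `sup_{swirl ≠ 0} ℋ_{P′} = +∞` for every classical pressure.

WHAT THIS IS NOT: not NS regularity, not the crux E — one more stratum of the crux CLASS 19832 (MODEL lattice; E/NS strata) `--supports` stmt-19832; the swirling axisymmetric needle
with `ℋ` unbounded on the swirl set, and every non-axisymmetric needle, stay OPEN.  [cite: ConstantinIgnatovaVicol2026Putative, §3.4.3 (3.30)–(3.33); Chae2007CMPEuler, Thm 2.2 +
Note added p. 6]
-/

noncomputable section

-- flat `Theorems/<Route><Decl>…` files of one crux share the namespace of the crux (tree convention: `Summit.<S>.<S>.…`)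
set_option linter.dupNamespace false

open MeasureTheory Set Filter Topology Metric Function InnerProductSpace
open scoped RealInnerProductSpace NNReal ContDiff

namespace Summit.NavierStokesRegularity.NavierStokesRegularity.Theorems.PowerGaugeEulerLiouville

open Literature.Analysis Literature.Analysis.FluidPDE Literature.Analysis.FunctionSpaces

namespace SwirlRatchet

variable {γ : ℝ} {U : EuclideanSpace ℝ (Fin 3) → EuclideanSpace ℝ (Fin 3)} {P : EuclideanSpace ℝ (Fin 3) → ℝ}

/-- **Linear escape under a kinetic budget**: `Y′ = −W(Y)` on `[1, τ]` with `∫₁^τ ‖W(Y)‖² ≤ B` ⇒ `‖Y τ − Y 1‖ ≤ (B + (τ − 1))/2`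
(`‖W‖ ≤ (‖W‖² + 1)/2` pointwise). [folklore] -/
theorem norm_sub_le_of_kinetic_budget (h : IsSelfSimilarEulerProfile γ 0 U P)
    {Y : ℝ → EuclideanSpace ℝ (Fin 3)} {τ B : ℝ} (hτ : 1 ≤ τ)
    (hY : ∀ t ∈ Icc 1 τ, HasDerivAt Y ((-1 : ℝ) • selfSimilarTransport γ 0 U (Y t)) t)
    (hB : ∫ t in (1 : ℝ)..τ, ‖selfSimilarTransport γ 0 U (Y t)‖ ^ 2 ≤ B) :
    ‖Y τ - Y 1‖ ≤ (B + (τ - 1)) / 2 := by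
  -- adapted from the LEAD's `Loc.norm_sub_le_integral_div_sqrt` (…SelfSimilarBernoulliBounded)
  have hWc : Continuous (selfSimilarTransport γ 0 U) :=
    (PowerGaugeEulerLiouville.Kelvin.contDiff_selfSimilarTransport (γ := γ) h.contDiff_velocity).continuous
  have hYc : ContinuousOn Y (Icc 1 τ) := fun t ht => (hY t ht).continuousAt.continuousWithinAt
  set f : ℝ → ℝ := fun t => ‖selfSimilarTransport γ 0 U (Y t)‖ with hf
  have hfc : ContinuousOn f (Icc 1 τ) := (hWc.comp_continuousOn hYc).norm
  have hf2c : ContinuousOn (fun t => f t ^ 2) (Icc 1 τ) := hfc.pow 2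
  have hfi : IntervalIntegrable f volume 1 τ := (hfc.mono (by rw [uIcc_of_le hτ])).intervalIntegrable
  have hder' : ∀ t ∈ uIcc 1 τ, HasDerivAt Y ((-1 : ℝ) • selfSimilarTransport γ 0 U (Y t)) t := by
    intro t ht; rw [uIcc_of_le hτ] at ht; exact hY t ht
  have hvc : ContinuousOn (fun t => (-1 : ℝ) • selfSimilarTransport γ 0 U (Y t)) (Icc 1 τ) :=
    (hWc.comp_continuousOn hYc).const_smul (-1 : ℝ)
  have hvi : IntervalIntegrable (fun t => (-1 : ℝ) • selfSimilarTransport γ 0 U (Y t)) volume 1 τ :=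
    (hvc.mono (by rw [uIcc_of_le hτ])).intervalIntegrable
  have hftc := intervalIntegral.integral_eq_sub_of_hasDerivAt hder' hvi
  have hdisp : ‖Y τ - Y 1‖ ≤ ∫ t in (1 : ℝ)..τ, f t := by
    rw [← hftc]
    refine (intervalIntegral.norm_integral_le_integral_norm hτ).trans (le_of_eq ?_)
    refine intervalIntegral.integral_congr fun t _ => ?_
    show ‖(-1 : ℝ) • selfSimilarTransport γ 0 U (Y t)‖ = ‖selfSimilarTransport γ 0 U (Y t)‖
    rw [norm_smul, norm_neg, norm_one, one_mul]
  -- `f ≤ (f² + 1)/2`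
  have hpt : ∀ t ∈ Icc (1 : ℝ) τ, f t ≤ (f t ^ 2 + 1) / 2 := fun t _ => by nlinarith [sq_nonneg (f t - 1)]
  have hmono : ∫ t in (1 : ℝ)..τ, f t ≤ ∫ t in (1 : ℝ)..τ, (f t ^ 2 + 1) / 2 :=
    intervalIntegral.integral_mono_on hτ hfi
      (((hf2c.add continuousOn_const).div_const _).mono (by rw [uIcc_of_le hτ])).intervalIntegrable hpt
  have hsplit : ∫ t in (1 : ℝ)..τ, (f t ^ 2 + 1) / 2 = ((∫ t in (1 : ℝ)..τ, f t ^ 2) + (τ - 1)) / 2 := by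
    have hf2i : IntervalIntegrable (fun t => f t ^ 2) volume 1 τ := (hf2c.mono (by rw [uIcc_of_le hτ])).intervalIntegrable
    rw [intervalIntegral.integral_div, intervalIntegral.integral_add hf2i (intervalIntegrable_const), intervalIntegral.integral_const,
      smul_eq_mul, mul_one]
  rw [hsplit] at hmono
  have h3 : ((∫ t in (1 : ℝ)..τ, f t ^ 2) + (τ - 1)) / 2 ≤ (B + (τ - 1)) / 2 := by linarith
  exact hdisp.trans (hmono.trans h3)

/-- **`ℋ` BOUNDED ABOVE ON THE SWIRL SET ⇒ NO SWIRL** (`γ < ½`; RESIDUE-MEMO-19832-g12 (A1) + the swirl ratchet).  `(U, P)` a `C²` self-similar Euler profile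
(CIV (3.3)), `U` axisymmetric of linear growth `‖U y‖ ≤ K₁(1+‖y‖)`, and `ℋ_P(y) ≤ Mb` at every `y` with `swirl U y ≠ 0`.  Then `U` is swirl-free: along the global
backward orbit from a swirling point, `ℋ ≤ Mb` (the swirl set is invariant), so the kinetic budget is finite and the orbit escapes only linearly in `τ`, while the
swirl grows like `e^{(1−2γ)τ}` and is `O(‖Y‖²) = O(τ²)` — absurd. [cite: ConstantinIgnatovaVicol2026Putative, §3.4.3 eq. (3.31)] -/
theorem hasNoSwirl_of_bernoulli_le (h : IsSelfSimilarEulerProfile γ 0 U P) (hU : IsAxisymmetric U) (hγ2 : γ < 1 / 2)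
    {K₁ : ℝ} (hlin : ∀ y, ‖U y‖ ≤ K₁ * (1 + ‖y‖)) {Mb : ℝ}
    (hMb : ∀ y, swirl U y ≠ 0 → selfSimilarBernoulli γ 0 U P y ≤ Mb) : HasNoSwirl U := by
  intro y
  by_contra hne
  have hK₁ : 0 ≤ K₁ := by
    have h0 := hlin 0
    rw [norm_zero, add_zero, mul_one] at h0
    exact (norm_nonneg _).trans h0
  have h12 : 0 < 1 - 2 * γ := by linarith
  -- the global backward orbit from `y`
  set Wb : EuclideanSpace ℝ (Fin 3) → EuclideanSpace ℝ (Fin 3) := fun z => -(selfSimilarTransport γ 0 U z) with hWb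
  have hWb1 : ContDiff ℝ 1 Wb :=
    (PowerGaugeEulerLiouville.Kelvin.contDiff_selfSimilarTransport (h.contDiff_velocity.of_le (by norm_num))).neg
  have hgrowth : ∀ z, ‖Wb z‖ ≤ (|γ| + K₁) * ‖z‖ + K₁ := by
    intro z
    rw [hWb]
    simp only [norm_neg, selfSimilarTransport_apply, sub_zero]
    calc ‖γ • z + U z‖ ≤ ‖γ • z‖ + ‖U z‖ := norm_add_le _ _
      _ ≤ |γ| * ‖z‖ + K₁ * (1 + ‖z‖) := by rw [norm_smul, Real.norm_eq_abs]; exact add_le_add le_rfl (hlin z)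
      _ = (|γ| + K₁) * ‖z‖ + K₁ := by ring
  obtain ⟨Y, hY0, hY, hY'⟩ := Loc.exists_forward_solution_of_linearGrowth hWb1 (by positivity) hK₁ hgrowth y
  have hYw : ∀ t, 0 ≤ t → HasDerivWithinAt Y (-(selfSimilarTransport γ 0 U (Y t))) (Ici 0) t :=
    fun t ht => by simpa only [hWb] using hY t ht
  have hYd : ∀ t, 0 < t → HasDerivAt Y ((-1 : ℝ) • selfSimilarTransport γ 0 U (Y t)) t := by
    intro t ht
    have h1 := hY' t ht
    simp only [hWb] at h1
    rwa [neg_one_smul]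
  -- the ratchet: the orbit stays in the swirl set, where `ℋ ≤ Mb`
  have hratchet : ∀ t, 0 ≤ t → swirl U (Y t) = swirl U y * Real.exp ((1 - 2 * γ) * t) := by
    intro t ht
    rw [← hY0]
    exact swirl_backward_orbit h hU hYw ht
  have hne' : ∀ t, 0 ≤ t → swirl U (Y t) ≠ 0 := fun t ht => by
    rw [hratchet t ht]; exact mul_ne_zero hne (Real.exp_pos _).ne'
  have hMbY : ∀ t, 0 ≤ t → selfSimilarBernoulli γ 0 U P (Y t) ≤ Mb := fun t ht => hMb _ (hne' t ht)
  -- kinetic budget and linear escape from time `1` on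
  set B : ℝ := (Mb - selfSimilarBernoulli γ 0 U P (Y 1)) / (1 - 2 * γ) with hBdef
  have hB0 : 0 ≤ B := by rw [hBdef]; exact div_nonneg (by linarith [hMbY 1 zero_le_one]) h12.le
  have hesc : ∀ τ, 1 ≤ τ → ‖Y τ‖ ≤ ‖Y 1‖ + (B + (τ - 1)) / 2 := by
    intro τ hτ
    have hYI : ∀ t ∈ Icc 1 τ, HasDerivAt Y ((-1 : ℝ) • selfSimilarTransport γ 0 U (Y t)) t :=
      fun t ht => hYd t (by linarith [ht.1])
    have hbud := Loc.integral_norm_transport_sq_eq h hτ hYI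
    have hI : ∫ t in (1 : ℝ)..τ, ‖selfSimilarTransport γ 0 U (Y t)‖ ^ 2 ≤ B := by
      rw [hBdef, le_div_iff₀ h12, mul_comm]
      rw [hbud]
      linarith [hMbY τ (by linarith)]
    have hd := norm_sub_le_of_kinetic_budget h hτ hYI hI
    have h1 : ‖Y τ‖ ≤ ‖Y 1‖ + ‖Y τ - Y 1‖ := norm_le_insert' _ _
    linarith
  -- polynomial vs exponential
  set α : ℝ := ‖Y 1‖ + B / 2 with hαdef
  have hα0 : 0 ≤ α := by rw [hαdef]; positivity
  have hesc' : ∀ τ, 1 ≤ τ → ‖Y τ‖ ≤ α + τ := fun τ hτ => by have := hesc τ hτ; rw [hαdef]; linarith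
  have hpos : 0 < |swirl U y| := abs_pos.2 hne
  set c : ℝ := 1 - 2 * γ with hc
  set τ : ℝ := max (max 1 α) (48 * K₁ / (|swirl U y| * c ^ 3) + 1) with hτdef
  have hτ1 : 1 ≤ τ := le_trans (le_max_left 1 α) (le_max_left _ _)
  have hτα : α ≤ τ := le_trans (le_max_right 1 α) (le_max_left _ _)
  have hτK : 48 * K₁ / (|swirl U y| * c ^ 3) < τ := lt_of_lt_of_le (lt_add_one _) (le_max_right _ _)
  have hτ0 : 0 < τ := by linarith
  -- upper bound `|Γ(Y τ)| ≤ 8 K₁ τ²`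
  have hup : |swirl U (Y τ)| ≤ 8 * K₁ * τ ^ 2 := by
    have hn : ‖Y τ‖ ≤ 2 * τ := by linarith [hesc' τ hτ1]
    have hn0 : 0 ≤ ‖Y τ‖ := norm_nonneg _
    calc |swirl U (Y τ)| ≤ ‖Y τ‖ * ‖U (Y τ)‖ := by
          rw [swirl_eq_inner_rotGen]
          exact (abs_real_inner_le_norm _ _).trans
            (mul_le_mul_of_nonneg_right (PineauVicol2026.norm_rotGen_le (Y τ)) (norm_nonneg _))
      _ ≤ ‖Y τ‖ * (K₁ * (1 + ‖Y τ‖)) := mul_le_mul_of_nonneg_left (hlin _) hn0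
      _ ≤ (2 * τ) * (K₁ * (1 + 2 * τ)) := by gcongr
      _ ≤ 8 * K₁ * τ ^ 2 := by
          have h1 : 0 ≤ 2 * K₁ * τ * (2 * τ - 1) :=
            mul_nonneg (mul_nonneg (mul_nonneg (by norm_num) hK₁) hτ0.le) (by linarith)
          nlinarith [h1]
  -- lower bound `|Γ(Y τ)| = |Γ(y)| e^{cτ} ≥ |Γ(y)| (cτ)³/6`
  have hlow : |swirl U y| * ((c * τ) ^ 3 / 6) ≤ |swirl U (Y τ)| := by
    rw [hratchet τ hτ0.le, abs_mul, abs_of_pos (Real.exp_pos _)]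
    refine mul_le_mul_of_nonneg_left ?_ hpos.le
    have h1 := Real.pow_div_factorial_le_exp (c * τ) (show 0 ≤ c * τ by positivity) 3
    have h2 : ((Nat.factorial 3 : ℕ) : ℝ) = 6 := by norm_num [Nat.factorial]
    rw [h2] at h1
    exact h1
  -- contradiction: `|Γ y| c³ τ³ / 6 ≤ 8 K₁ τ²` forces `τ ≤ 48 K₁ /(|Γ y| c³)`
  have hfin : |swirl U y| * ((c * τ) ^ 3 / 6) ≤ 8 * K₁ * τ ^ 2 := hlow.trans hup
  have hcontra : τ ≤ 48 * K₁ / (|swirl U y| * c ^ 3) := by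
    rw [le_div_iff₀ (by positivity)]
    have e : |swirl U y| * ((c * τ) ^ 3 / 6) = (τ * (|swirl U y| * c ^ 3)) * τ ^ 2 / 6 := by ring
    rw [e] at hfin
    have hτ2 : 0 < τ ^ 2 := by positivity
    nlinarith
  linarith

end SwirlRatchet

/-! ### Member form -/

namespace SwirlRatchet

variable {u : ℝ → EuclideanSpace ℝ (Fin 3) → EuclideanSpace ℝ (Fin 3)} {p : ℝ → EuclideanSpace ℝ (Fin 3) → ℝ}
  {H : ℝ → EuclideanSpace ℝ (Fin 3) → EuclideanSpace ℝ (Fin 3) →L[ℝ] EuclideanSpace ℝ (Fin 3)} {c : ℝ≥0}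
  {V : EuclideanSpace ℝ (Fin 3) → EuclideanSpace ℝ (Fin 3)} {P : EuclideanSpace ℝ (Fin 3) → ℝ}

/-- **MEMBER FORM: AN AXISYMMETRIC `C²` NEEDLE OF LINEAR GROWTH WHOSE BERNOULLI FUNCTION IS BOUNDED ABOVE ON THE SWIRL SET IS TRIVIAL — NO PRESSURE CLAUSE.**
Crux binders verbatim (`0 < ρ ≤ ½`) + exactly self-similar ansatz about the origin + `ContDiff ℝ 2 V` + `IsAxisymmetric V` + `‖V y‖ ≤ K₁(1+‖y‖)` + «for every classical
pressure `P′` of `V` (`IsSelfSimilarEulerProfile (1/(2+ρ)) 0 V P′`) some `Mb` bounds `ℋ_{P′}` on `{swirl V ≠ 0}`» ⇒ `u = 0` a.e.  (Classical pressure by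
`WeakToClassical.exists_isSelfSimilarEulerProfile_of_contDiff`; `hasNoSwirl_of_bernoulli_le`; (S37) `NeedleRace.selfSimilar_ae_eq_zero_of_axisymNoSwirlC2`.)
[cite: ConstantinIgnatovaVicol2026Putative, §3.4.3 eq. (3.31)] -/
theorem selfSimilar_ae_eq_zero_of_axisym_bernoulliBounded_C2 {ρ : ℝ} (hρ : 0 < ρ) (hρ1 : ρ ≤ 1 / 2)
    (hsw : IsSuitableWeakSolutionOn (slab (EuclideanSpace ℝ (Fin 3)) (Iio 0) isOpen_Iio) 0 0 u p)
    (hH : HasWeakSpatialGradientOn (slab (EuclideanSpace ℝ (Fin 3)) (Iio 0) isOpen_Iio) u H)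
    (hgauge : ∀ a : ℝ, 0 < a →
      ENNReal.ofReal (a ^ (2 * ρ)) * cknA a (0 : ℝ × EuclideanSpace ℝ (Fin 3)) u +
          ENNReal.ofReal (a ^ ρ) * cknE a (0 : ℝ × EuclideanSpace ℝ (Fin 3)) H +
        ENNReal.ofReal (a ^ (2 * ρ)) * cknD a (0 : ℝ × EuclideanSpace ℝ (Fin 3)) p ≤ (c : ENNReal))
    (hu : ∀ τ : ℝ, τ < 0 → u τ = selfSimilarCollapse (1 / (2 + ρ)) 0 V τ)
    (hp : ∀ τ : ℝ, τ < 0 → p τ = selfSimilarCollapsePressure (1 / (2 + ρ)) 0 P τ)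
    (hV : ContDiff ℝ 2 V) (hax : IsAxisymmetric V)
    (hlin : ∃ K₁ : ℝ, ∀ y, ‖V y‖ ≤ K₁ * (1 + ‖y‖))
    (hB : ∀ P' : EuclideanSpace ℝ (Fin 3) → ℝ, IsSelfSimilarEulerProfile (1 / (2 + ρ)) 0 V P' →
      ∃ Mb : ℝ, ∀ y, swirl V y ≠ 0 → selfSimilarBernoulli (1 / (2 + ρ)) 0 V P' y ≤ Mb) :
    uncurry u =ᵐ[volume.restrict (Iio (0 : ℝ) ×ˢ (univ : Set (EuclideanSpace ℝ (Fin 3))))] 0 := by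
  obtain ⟨K₁, hK₁⟩ := hlin
  have hρ1' : ρ < 1 := by linarith
  have h2ρ : (0 : ℝ) < 2 + ρ := by linarith
  have hγ2 : 1 / (2 + ρ) < 1 / 2 := one_div_lt_one_div_of_lt two_pos (by linarith)
  -- a classical pressure of the profile (boilerplate of the lineage's member theorems)
  have hD : ∀ a : ℝ, 0 < a → ENNReal.ofReal (a ^ (2 * ρ)) *
      cknD a (0 : ℝ × EuclideanSpace ℝ (Fin 3)) p ≤ (c : ENNReal) :=
    fun a ha => le_trans le_add_self (hgauge a ha)
  have hpm : AEStronglyMeasurable (uncurry p)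
      (volume.restrict (Iio (0 : ℝ) ×ˢ (univ : Set (EuclideanSpace ℝ (Fin 3))))) := by
    have := hsw.distributional.2.2.1.aestronglyMeasurable
    simpa [slab] using this
  have hPm := aestronglyMeasurable_pressureProfile hpm hp
  have hDprof := profile_pressure_weight_of_gaugeD hρ hρ1' hpm hp hD
  have hP1 : LocallyIntegrable P volume :=
    EnergySaturation.locallyIntegrable_pressure_of_weight hρ1' hPm
      (ENNReal.mul_ne_top ENNReal.ofReal_ne_top ENNReal.coe_ne_top) hDprof
  obtain ⟨P', hprof⟩ := WeakToClassical.exists_isSelfSimilarEulerProfile_of_contDiff hsw.distributional hu hp hV hP1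
  obtain ⟨Mb, hMb⟩ := hB P' hprof
  have hns : HasNoSwirl V := hasNoSwirl_of_bernoulli_le hprof hax hγ2 hK₁ hMb
  exact NeedleRace.selfSimilar_ae_eq_zero_of_axisymNoSwirlC2 hρ hρ1 hsw hH hgauge hu hp hV hax hns

end SwirlRatchet

end Summit.NavierStokesRegularity.NavierStokesRegularity.Theorems.PowerGaugeEulerLiouville

end
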